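import Literature.Computability.AlgebraicComplexity.BorderComplexityAlder
import HarnessLib

/-!
# `\underline{L}` under sums, products and scalars; `\overline{VP}` is closed under ring operations
# (Bürgisser 2004, Lemma 2.1(3); BLMW 2011 §9.3; Bürgisser 2024 survey, Def. 4.23) — PROVED

Topic `Computability/AlgebraicComplexity`. Cell `val-lit`, row Bur2024-A (Bürgisser 2024 survey,
§4.7 "Closures of complexity classes", Def. 4.23: the class `\overline{VP}`), companion of
`BorderComplexityAlder.lean` / `ApproxComplexitySubstitution.lean`. Bürgisser 2004, Lemma 2.1(3)
(held text `paper:arxiv-1812.06828`, p0007 L11–L15): "(Transitivity) The approximative complexity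
`L̲(f | g)` to compute `f` from `g` and the variables is defined in a natural way. We have
`L̲(f) ≤ L̲(f | g) + L̲(g)`, and an analogous inequality is true for the computation of several
polynomials." The tree has no relative measure `L̲(· | ·)`; this file records the special cases
that are used as API — computing `f + g`, `f · g`, `c · f` from `f`, `g` costs one gate — for the
tree's `ε`-rendering `borderComplexity` (`ApproximativeRootClosure.lean`: a fan-in-two circuit over
`F((ε))` computing `f + O(ε)`, any field `F`), exactly parallel to `complexity_add_le`,
`complexity_mul_le`, `complexity_smul_le` (`ArithCircuit.lean`):

* `borderComplexity_C`, `borderComplexity_X` (`= 0`), `borderComplexity_add_le`,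
  `borderComplexity_mul_le`, `borderComplexity_C_mul_le`, `borderComplexity_smul_le`,
  `borderComplexity_neg_le`, `borderComplexity_sub_le`, `borderComplexity_sum_le`,
  `borderComplexity_prod_le` (run the border computations side by side: the error terms stay
  `O(ε)` by `PolyOrdGE.add` / `PolyOrdGE.mul`);
* over `ℂ`, by Alder's theorem (`approxComplexity_eq_borderComplexity`), the same for the
  ZARISKI rendering `approxComplexity` (BLMW 2011 Def. 9.3.1): `approxComplexity_add_le`,
  `approxComplexity_mul_le`, `approxComplexity_C_mul_le`;
* **`\overline{VP}` is closed under sums, products and scalar multiples**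
  (`IsVPBarFamily.add`, `IsVPBarFamily.mul`, `IsVPBarFamily.C_mul`, `IsVPBarFamily.neg`,
  `IsVPBarFamily.sub`) for the tree's class `IsVPBarFamily` (BLMW 2011 §9.3; the survey's
  Def. 4.23), the `\overline{VP}` analogue of `VPClosedUnderSum.lean`.

Theorems only; 0 definitions, 0 named facts. Honest framing: elementary closure bookkeeping of a
definition; nothing here bears on `VP` versus `\overline{VP}` versus `VNP`; `VP ≠ VNP` is NOT
proved.

## References

* [Burgisser2004Factors] P. Bürgisser, *The complexity of factors of multivariate polynomials*,
  Found. Comput. Math. 4 (2004) = arXiv:1812.06828, Def. 2.1 and Lemma 2.1(3) (p0006–p0007).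
* [BurgisserEtAl2011] Bürgisser–Landsberg–Manivel–Weyman, SIAM J. Comput. 40 (2011), §9.3
  (`\overline{VP}`).
* [Burgisser2024Completeness] P. Bürgisser, arXiv:2406.06217 (2024), §4.7, Def. 4.23 (p0021).
-/

noncomputable section

open MvPolynomial

namespace Literature.Computability.AlgebraicComplexity

universe u v

/-! ## `\underline{L}` over any field: one gate per ring operation -/

section Border

variable {F : Type u} [Field F] {σ : Type v}

/-- Constants are free: `L̲(c) = 0`. [cite: Burgisser2004Factors, Def. 2.1 (p0006 L53–L60)] -/
theorem borderComplexity_C (c : F) : borderComplexity (C c : MvPolynomial σ F) = 0 :=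
  Nat.eq_zero_of_le_zero ((borderComplexity_le_complexity _).trans (complexity_C_holds c).le)

/-- Variables are free: `L̲(X_i) = 0`. [cite: Burgisser2004Factors, Def. 2.1 (p0006 L53–L60)] -/
theorem borderComplexity_X (i : σ) : borderComplexity (X i : MvPolynomial σ F) = 0 :=
  Nat.eq_zero_of_le_zero ((borderComplexity_le_complexity _).trans (complexity_X_holds i).le)

/-- A border computation `h = f + O(ε)` is `O(1)` coefficientwise. [cite: Burgisser2004Factors, Def. 2.1 (p0006 L53–L60)] -/
private theorem polyOrdGE_zero_of_border {f : MvPolynomial σ F} {h : MvPolynomial σ (LaurentSeries F)}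
    (hh : PolyOrdGE 1 (h - MvPolynomial.map (algebraMap F (LaurentSeries F)) f)) : PolyOrdGE 0 h := by
  have := (hh.mono (show (0 : ℤ) ≤ 1 by norm_num)).add (PolyOrdGE.map_algebraMap f)
  rwa [sub_add_cancel] at this

/-- **Sums: `L̲(f + g) ≤ L̲(f) + L̲(g) + 1`** (add the two border computations; Bürgisser 2004,
Lemma 2.1(3), the case "compute `f + g` from `f, g`").
[cite: Burgisser2004Factors, Lemma 2.1(3) (transitivity, p0007 L11–L15)] -/
theorem borderComplexity_add_le (f g : MvPolynomial σ F) :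
    borderComplexity (f + g) ≤ borderComplexity f + borderComplexity g + 1 := by
  obtain ⟨hf, hcf, hhf⟩ := exists_polyOrdGE_complexity_le f
  obtain ⟨hg, hcg, hhg⟩ := exists_polyOrdGE_complexity_le g
  refine (borderComplexity_le_of_polyOrdGE (hf + hg) ?_).trans
    ((complexity_add_le_holds hf hg).trans (by omega))
  rw [map_add, add_sub_add_comm]
  exact hhf.add hhg

/-- **Products: `L̲(f g) ≤ L̲(f) + L̲(g) + 1`** (multiply the two border computations:
`(f + O(ε))(g + O(ε)) = f g + O(ε)`; Bürgisser 2004, Lemma 2.1(3), the case "compute `f g` from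
`f, g`"). [cite: Burgisser2004Factors, Lemma 2.1(3) (transitivity, p0007 L11–L15)] -/
theorem borderComplexity_mul_le (f g : MvPolynomial σ F) :
    borderComplexity (f * g) ≤ borderComplexity f + borderComplexity g + 1 := by
  obtain ⟨hf, hcf, hhf⟩ := exists_polyOrdGE_complexity_le f
  obtain ⟨hg, hcg, hhg⟩ := exists_polyOrdGE_complexity_le g
  refine (borderComplexity_le_of_polyOrdGE (hf * hg) ?_).trans
    ((complexity_mul_le_holds hf hg).trans (by omega))
  set ι := algebraMap F (LaurentSeries F)
  have key : hf * hg - MvPolynomial.map ι (f * g) =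
      hf * (hg - MvPolynomial.map ι g) + (hf - MvPolynomial.map ι f) * MvPolynomial.map ι g := by
    rw [map_mul]
    ring
  rw [key]
  refine PolyOrdGE.add ?_ ?_
  · simpa using (polyOrdGE_zero_of_border hhf).mul hhg
  · simpa using hhf.mul (PolyOrdGE.map_algebraMap g)

/-- **Scalars: `L̲(c · f) ≤ L̲(f) + 1`** (one scalar gate; Bürgisser 2004, Lemma 2.1(3), the case
"compute `c f` from `f`"). [cite: Burgisser2004Factors, Lemma 2.1(3) (transitivity, p0007 L11–L15)] -/
theorem borderComplexity_C_mul_le (c : F) (f : MvPolynomial σ F) :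
    borderComplexity (C c * f) ≤ borderComplexity f + 1 := by
  obtain ⟨hf, hcf, hhf⟩ := exists_polyOrdGE_complexity_le f
  set ι := algebraMap F (LaurentSeries F)
  refine (borderComplexity_le_of_polyOrdGE (C (ι c) * hf) ?_).trans ?_
  · have key : C (ι c) * hf - MvPolynomial.map ι (C c * f) =
        C (ι c) * (hf - MvPolynomial.map ι f) := by
      rw [map_mul, map_C, mul_sub]
    rw [key]
    have hc : PolyOrdGE 0 (C (ι c) : MvPolynomial σ (LaurentSeries F)) := by
      refine PolyOrdGE.C ?_
      rw [algebraMap_laurentSeries_apply]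
      exact IsOrdGE.C c
    simpa using hc.mul hhf
  · rw [← smul_eq_C_mul]
    exact (complexity_smul_le_holds _ _).trans (Nat.add_le_add_right hcf 1)

/-- `L̲(c • f) ≤ L̲(f) + 1`. [cite: Burgisser2004Factors, Lemma 2.1(3) (transitivity, p0007 L11–L15)] -/
theorem borderComplexity_smul_le (c : F) (f : MvPolynomial σ F) :
    borderComplexity (c • f) ≤ borderComplexity f + 1 := by
  rw [smul_eq_C_mul]
  exact borderComplexity_C_mul_le c f

/-- `L̲(-f) ≤ L̲(f) + 1`. [cite: Burgisser2004Factors, Lemma 2.1(3) (transitivity, p0007 L11–L15)] -/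
theorem borderComplexity_neg_le (f : MvPolynomial σ F) :
    borderComplexity (-f) ≤ borderComplexity f + 1 := by
  have h := borderComplexity_C_mul_le (-1 : F) f
  rwa [C_neg, C_1, neg_one_mul] at h

/-- `L̲(f - g) ≤ L̲(f) + L̲(g) + 2`. [cite: Burgisser2004Factors, Lemma 2.1(3) (transitivity, p0007 L11–L15)] -/
theorem borderComplexity_sub_le (f g : MvPolynomial σ F) :
    borderComplexity (f - g) ≤ borderComplexity f + borderComplexity g + 2 := by
  rw [sub_eq_add_neg]
  have h := borderComplexity_neg_le g
  have h' := borderComplexity_add_le f (-g)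
  omega

/-- Finite sums: `L̲(Σ_{i ∈ s} u_i) ≤ Σ_{i ∈ s} L̲(u_i) + #s`. [cite: Burgisser2004Factors, Lemma 2.1(3) (transitivity, several polynomials, p0007 L11–L15)] -/
theorem borderComplexity_sum_le {ι : Type*} (s : Finset ι) (u : ι → MvPolynomial σ F) :
    borderComplexity (∑ i ∈ s, u i) ≤ ∑ i ∈ s, borderComplexity (u i) + s.card := by
  classical
  induction s using Finset.induction_on with
  | empty =>
    rw [Finset.sum_empty, Finset.sum_empty, Finset.card_empty, ← C_0, borderComplexity_C]
  | insert a s ha ih =>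
    rw [Finset.sum_insert ha, Finset.sum_insert ha, Finset.card_insert_of_notMem ha]
    have h := borderComplexity_add_le (u a) (∑ i ∈ s, u i)
    omega

/-- Finite products: `L̲(∏_{i ∈ s} u_i) ≤ Σ_{i ∈ s} L̲(u_i) + #s`. [cite: Burgisser2004Factors, Lemma 2.1(3) (transitivity, several polynomials, p0007 L11–L15)] -/
theorem borderComplexity_prod_le {ι : Type*} (s : Finset ι) (u : ι → MvPolynomial σ F) :
    borderComplexity (∏ i ∈ s, u i) ≤ ∑ i ∈ s, borderComplexity (u i) + s.card := by
  classical
  induction s using Finset.induction_on with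
  | empty =>
    rw [Finset.prod_empty, Finset.sum_empty, Finset.card_empty, ← C_1, borderComplexity_C]
  | insert a s ha ih =>
    rw [Finset.prod_insert ha, Finset.sum_insert ha, Finset.card_insert_of_notMem ha]
    have h := borderComplexity_mul_le (u a) (∏ i ∈ s, u i)
    omega

end Border

/-! ## Over `ℂ`: the Zariski rendering `approxComplexity`, via Alder's theorem -/

section Approx

variable {σ : Type*} [Fintype σ] [DecidableEq σ]

/-- **`\underline{L}(f + g) ≤ \underline{L}(f) + \underline{L}(g) + 1` over `ℂ`** for the tree's
`approxComplexity` (BLMW 2011 Def. 9.3.1), by Alder's theorem and `borderComplexity_add_le`.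
[cite: Burgisser2004Factors, Lemma 2.1(3) (transitivity, p0007 L11–L15)] [cite: BurgisserEtAl2011, Def. 9.3.1] -/
theorem approxComplexity_add_le (f g : MvPolynomial σ ℂ) :
    approxComplexity (f + g) ≤ approxComplexity f + approxComplexity g + 1 := by
  simp only [approxComplexity_eq_borderComplexity]
  exact borderComplexity_add_le f g

/-- **`\underline{L}(f g) ≤ \underline{L}(f) + \underline{L}(g) + 1` over `ℂ`** (Zariski rendering).
[cite: Burgisser2004Factors, Lemma 2.1(3) (transitivity, p0007 L11–L15)] [cite: BurgisserEtAl2011, Def. 9.3.1] -/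
theorem approxComplexity_mul_le (f g : MvPolynomial σ ℂ) :
    approxComplexity (f * g) ≤ approxComplexity f + approxComplexity g + 1 := by
  simp only [approxComplexity_eq_borderComplexity]
  exact borderComplexity_mul_le f g

/-- **`\underline{L}(c f) ≤ \underline{L}(f) + 1` over `ℂ`** (Zariski rendering).
[cite: Burgisser2004Factors, Lemma 2.1(3) (transitivity, p0007 L11–L15)] [cite: BurgisserEtAl2011, Def. 9.3.1] -/
theorem approxComplexity_C_mul_le (c : ℂ) (f : MvPolynomial σ ℂ) :
    approxComplexity (C c * f) ≤ approxComplexity f + 1 := by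
  simp only [approxComplexity_eq_borderComplexity]
  exact borderComplexity_C_mul_le c f

end Approx

/-! ## `\overline{VP}` is closed under sums, products and scalar multiples -/

section Classes

variable {σ : ℕ → Type*} [∀ n, Fintype (σ n)] [∀ n, DecidableEq (σ n)]

/-- **`\overline{VP}` is closed under scalar multiples** `C (a n) · f n` (BLMW 2011 §9.3's class;
Bürgisser 2024 Def. 4.23). [cite: BurgisserEtAl2011, §9.3 (\overline{VP})] [cite: Burgisser2024Completeness, Def. 4.23 (§4.7, p0021)] -/
theorem IsVPBarFamily.C_mul {f : ∀ n, MvPolynomial (σ n) ℂ} (hf : IsVPBarFamily f) (a : ℕ → ℂ) :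
    IsVPBarFamily fun n => C (a n) * f n :=
  (IsPBounded.add_holds hf (IsPBounded.const 1)).mono fun _ => approxComplexity_C_mul_le _ _

/-- **`\overline{VP}` is closed under sums.** [cite: BurgisserEtAl2011, §9.3 (\overline{VP})] [cite: Burgisser2024Completeness, Def. 4.23 (§4.7, p0021)] -/
theorem IsVPBarFamily.add {f g : ∀ n, MvPolynomial (σ n) ℂ} (hf : IsVPBarFamily f)
    (hg : IsVPBarFamily g) : IsVPBarFamily fun n => f n + g n :=
  (IsPBounded.add_holds (IsPBounded.add_holds hf hg) (IsPBounded.const 1)).mono fun _ =>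
    approxComplexity_add_le _ _

/-- **`\overline{VP}` is closed under products.** [cite: BurgisserEtAl2011, §9.3 (\overline{VP})] [cite: Burgisser2024Completeness, Def. 4.23 (§4.7, p0021)] -/
theorem IsVPBarFamily.mul {f g : ∀ n, MvPolynomial (σ n) ℂ} (hf : IsVPBarFamily f)
    (hg : IsVPBarFamily g) : IsVPBarFamily fun n => f n * g n :=
  (IsPBounded.add_holds (IsPBounded.add_holds hf hg) (IsPBounded.const 1)).mono fun _ =>
    approxComplexity_mul_le _ _

/-- **`\overline{VP}` is closed under negation.** [cite: BurgisserEtAl2011, §9.3 (\overline{VP})] [cite: Burgisser2024Completeness, Def. 4.23 (§4.7, p0021)] -/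
theorem IsVPBarFamily.neg {f : ∀ n, MvPolynomial (σ n) ℂ} (hf : IsVPBarFamily f) :
    IsVPBarFamily fun n => -f n := by
  have h := hf.C_mul fun _ => -1
  simpa using h

/-- **`\overline{VP}` is closed under differences.** [cite: BurgisserEtAl2011, §9.3 (\overline{VP})] [cite: Burgisser2024Completeness, Def. 4.23 (§4.7, p0021)] -/
theorem IsVPBarFamily.sub {f g : ∀ n, MvPolynomial (σ n) ℂ} (hf : IsVPBarFamily f)
    (hg : IsVPBarFamily g) : IsVPBarFamily fun n => f n - g n := by
  have h := hf.add hg.neg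
  simpa [sub_eq_add_neg] using h

end Classes

end Literature.Computability.AlgebraicComplexity

end
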